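import Summits.QuantumAdvantage.QuantumAdvantage.Theorems.WalkNoPerfectKForm
import Summits.QuantumAdvantage.QuantumAdvantage.Theorems.PerfectDialExact
import Summits.QuantumAdvantage.QuantumAdvantage.Theorems.CharDialTowerDefs
import Summits.QuantumAdvantage.QuantumAdvantage.Theorems.CharDialTokenDialT
import HarnessLib

/-!
# Inverse-polynomial LOSS for every `k`-form / junta ⊕ linear-form (JLin) strategy of the u-walk game, `p ≥ 5` — PART A
(Part A = §1–§3: the subcube law for `k`-form strategies, its instantiation at every prime `p ≥ 5`, and the counting inequality; Part B = `Theorems.WalkKFormLossB`: §4–§7, the item-level consequences.  The overview below covers both parts.)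
(cell decomp-qadv, lens 6 «barrier-complement carving», g20; tree-ready, Prop-definition-free)

The characteristic-two product-function method of `Coset21.CharTwoKill` (Barrington–Straubing–Thérien 1990, Thm 7, in
`𝔽₂(μ_{3p})`: the fire count of a `k`-form strategy is a `2p^k(n+1)`-term sum of cube characters with coordinates
`ω^x ζ^{±1}`) was used in the tree for the EXACT axis only beyond linear tests: `Coset21.noPerfectKFormOdd` (no perfect
`k`-form strategy), `PerfectDial.noPerfect_jlin_log` (the exact shadow of CharDial item 32604), while the DISTRIBUTIONAL
form (a loser in every subcube, `2^{n−m}` losers once `#terms·(2p−1)^m < (2p)^m`) was recorded for linear tests only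
(`Coset21.linSelSubcubeLossOdd`, stmt-22607).  This file carries the subcube argument over to `k`-form strategies — the
class is closed under freezing coordinates (the frozen part of each form is absorbed into the table, the frozen walk weights
into the cut constant) — and packages the consequence for the JLin class of route CharDial:

* `CharTwoKill.subcubeK_filter_eq`, `CharTwoKill.kForm_loss_lower_bound_add`, `CharTwoKill.kForm_loss_lower_bound` — over any
  field of characteristic two with the two roots of unity: if `m ≤ n` and `(n+1)·2p^k·(2p−1)^m < (2p)^m` then every `k`-form
  strategy loses on `≥ 2^{n−m}` inputs;
* `kForm_loss_ge`, `kFormSubcubeLossOdd` — the same in `CyclotomicField (3p) (ZMod 2)`, every prime `p ≥ 5`;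
* `jlin_loss_ge` — junta(`≤ L`) ⊕ one form = `(L+1)`-form (`PerfectDial.kform_of_jlin`), hence the same bound with `k = L+1`;
* `count_log_loss` — with `k₀ = k₀(p)` and `m = k₀·log₂ n` the counting inequality holds for `L = log₂ n` and all large `n`;
* `jlinPolyLossOdd` — **THE INVERSE-POLYNOMIAL SHADOW OF ITEM 32604 (`CharDial.WalkHardFJLinOdd`) AND OF BOTH RESIDUAL PIECES
  27206 / 27207, PROVED**: for every prime `p ≥ 5` there are `k, n₀` with `2ⁿ ≤ n^k · #{u : the strategy loses at u}` for every
  `n ≥ n₀`, every charge and every strategy whose cuts are juntas of size `≤ log₂ n` ⊕ ONE `𝔽_p`-linear form;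
  `jlinPolyLossOdd_towerDefs` (hypothesis `JLinPeel.TowerDefs.JLinHyp` by name) and `jlinPolyLossOdd_real` (the conclusion in
  the currency of `AbsorptionDial.WalkPolyLossOdd`, item 26767: `#WIN ≤ (1 − n^{−k})·2ⁿ`) — the JLin slice of 26767 is a theorem;
* `polyLossFrob_of_frobStructureLawOdd` / `polyLossFrob_of_frobStructureLaw` — **the `1/poly` FROBENIUS NOTCH (cuts of `𝔽_p`-degree
  `≤ p − 1`, every `p ≥ 5`) FROM THE STRUCTURE LAW ALONE** (item 27205, resp. the aside 32603): at inverse-polynomial loss the two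
  residual pieces 27206 / 27207 of `FrobHardOdd` are not needed (exact-grade analogue: `PerfectDial.noPerfect_of_frobStructureLaw`);
* `kFormPolyLossOdd` — the `1/poly` loss law for `K`-form strategies, `K` fixed; `polyLossDeg_of_structureLawK` /
  `noPerfectDeg_of_structureLawK` — **every DEGREE RUNG `d` of the `1/poly` and exact ladders follows from a `K`-form STRUCTURE LAW at
  degree `d` ALONE** (definition-free, the hypothesis shape of `AbsorptionDial.degF_fail_floor_of_junta`; `d ≤ p−2`: junta law of
  arXiv:1910.12458 Thm 2; `d = p−1`: item 27205; `p ≤ d ≤ 2p−3`: the conjectural second structure law of the lens-6 g20 node);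
* `formPolyLossOdd` / `formPolyLossOdd_real` — the `1/poly` shadow of the PURE-FORM CORE `JLinPeel.TowerDefs.FormHard`
  (`Theorems.CharDialTokenDialT`), PROVED.

Ceiling of the method (recorded, not claimed beyond): the argument shows that every subcube obtained by freezing `n − m` coordinates
contains a losing input; a set meeting every such subcube may have density `2^{−m}`, so the constant-θ statements (32604, 27206, 27207,
R5, `FormHard`) are NOT touched.

0 sorry; axioms standard; no `instance`, no `notation`, no `native_decide`.
-/

open Finset

namespace Summit.QuantumAdvantage.AdviceFreeQNC0

namespace Coset21

namespace CharTwoKill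

/-! ### §1 `k`-form strategies restricted to a subcube are `k`-form strategies -/

section SubcubeK

variable {p : ℕ} [Fact p.Prime] {K : Type*} [Field K] [CharP K 2]

/-- restricted data for a `k`-form strategy on the subcube with the LAST `q` coordinates frozen to `v`: cut `g` has forms
`lam g j ∘ castAdd`, table `x ↦ F g (x + frozen part of the forms)`, constant `c + g + frozen walk weight`, weights `ww g ∘ castAdd`. -/
theorem subcubeK_filter_eq {m q k : ℕ} (c : ℕ) (y : Fin (m + q + 1) → (Fin (m + q) → Bool) → Bool)
    (lam : Fin (m + q + 1) → Fin k → Fin (m + q) → ZMod p) (F : Fin (m + q + 1) → (Fin k → ZMod p) → Bool)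
    (hy : ∀ g u, y g u = F g (fun j => ∑ i, if u i = true then lam g j i else 0))
    (v : Fin q → Bool) (u' : Fin m → Bool) :
    (univ.filter fun g : Fin (m + q + 1) =>
        y g (Fin.append u' v) = true ∧ (c + g.val + walkExp (Fin.append u' v) g.val) % 3 ≠ 0)
      = (univ.filter fun g : Fin (m + q + 1) =>
          F g (fun j => kForm (fun (g' : Fin (m + q + 1)) (j : Fin k) (i : Fin m) => lam g' j (Fin.castAdd q i)) g u' j
              + ∑ j', if v j' = true then lam g j (Fin.natAdd m j') else 0) = true ∧
            ((c + g.val + ∑ j', if v j' = true then ww g.val (Fin.natAdd m j') else 0)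
              + wForm (fun (g' : Fin (m + q + 1)) (i : Fin m) => ww g'.val (Fin.castAdd q i)) g u') % 3 ≠ 0) := by
  refine filter_congr fun g _ => ?_
  have hform : (fun j => ∑ i, if Fin.append u' v i = true then lam g j i else 0)
      = fun j => kForm (fun (g' : Fin (m + q + 1)) (j : Fin k) (i : Fin m) => lam g' j (Fin.castAdd q i)) g u' j
          + ∑ j', if v j' = true then lam g j (Fin.natAdd m j') else 0 := by
    funext j
    unfold kForm
    rw [Fin.sum_univ_add]
    simp only [Fin.append_left, Fin.append_right]
  have hwalk : walkExp (Fin.append u' v) g.val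
      = wForm (fun (g' : Fin (m + q + 1)) (i : Fin m) => ww g'.val (Fin.castAdd q i)) g u'
          + ∑ j', if v j' = true then ww g.val (Fin.natAdd m j') else 0 := by
    rw [walkExp_eq_sum, Fin.sum_univ_add]
    unfold wForm
    simp only [Fin.append_left, Fin.append_right]
  rw [hy g _, hform, hwalk]
  constructor
  · rintro ⟨h1, h2⟩
    exact ⟨h1, fun h => h2 (by omega)⟩
  · rintro ⟨h1, h2⟩
    exact ⟨h1, fun h => h2 (by omega)⟩

/-- **Subcube loss bound for `k`-form strategies (counting form).**  If `(m+q+1)·2p^k·(2p−1)^m < (2p)^m` then every `k`-form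
strategy on `n = m + q` bits loses on at least `2^q` inputs (one in each subcube with the last `q` coordinates frozen). -/
theorem kForm_loss_lower_bound_add (ω ζ : K) (hω : IsPrimitiveRoot ω p) (hζ : IsPrimitiveRoot ζ 3)
    (hp5 : 5 ≤ p) (m q k : ℕ)
    (hcount : (m + q + 1) * (p ^ k * 2) * (2 * p - 1) ^ m < (2 * p) ^ m) (c : ℕ)
    (lam : Fin (m + q + 1) → Fin k → Fin (m + q) → ZMod p) (F : Fin (m + q + 1) → (Fin k → ZMod p) → Bool)
    (y : Fin (m + q + 1) → (Fin (m + q) → Bool) → Bool)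
    (hy : ∀ g u, y g u = F g (fun j => ∑ i, if u i = true then lam g j i else 0)) :
    2 ^ q ≤ (univ.filter fun u : Fin (m + q) → Bool => ringWinU c y u = false).card := by
  classical
  -- one loser per frozen assignment v
  have hloser : ∀ v : Fin q → Bool, ∃ u' : Fin m → Bool, ringWinU c y (Fin.append u' v) = false := by
    intro v
    have hcount' : Fintype.card (Fin (m + q + 1)) * (p ^ k * 2) * (2 * p - 1) ^ m < (2 * p) ^ m := by
      rw [Fintype.card_fin]; exact hcount
    obtain ⟨u', hu'⟩ := abstract_even_existsK ω ζ hω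
      (fun (g' : Fin (m + q + 1)) (j : Fin k) (i : Fin m) => lam g' j (Fin.castAdd q i))
      (fun (g' : Fin (m + q + 1)) (x : Fin k → ZMod p) =>
          F g' (fun j => x j + ∑ j', if v j' = true then lam g' j (Fin.natAdd m j') else 0))
      (fun g : Fin (m + q + 1) => c + g.val + ∑ j', if v j' = true then ww g.val (Fin.natAdd m j') else 0)
      (fun (g : Fin (m + q + 1)) (i : Fin m) => ww g.val (Fin.castAdd q i)) hp5 hζ (fun g i => ww_mem g.val _) hcount'
    refine ⟨u', ?_⟩
    rw [Bool.eq_false_iff]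
    intro hwin
    simp only [ringWinU, decide_eq_true_eq] at hwin
    rw [subcubeK_filter_eq c y lam F hy v u'] at hwin
    omega
  -- the projection to the frozen coordinates is onto from the loss set
  have hsurj : Set.SurjOn (fun u : Fin (m + q) → Bool => fun j : Fin q => u (Fin.natAdd m j))
      ↑(univ.filter fun u : Fin (m + q) → Bool => ringWinU c y u = false) ↑(univ : Finset (Fin q → Bool)) := by
    intro v _
    obtain ⟨u', hu'⟩ := hloser v
    refine ⟨Fin.append u' v, ?_, ?_⟩
    · simp [hu']
    · funext j; simp [Fin.append_right]
  have := card_le_card_of_surjOn _ hsurj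
  simpa [card_univ, Fintype.card_fin, Fintype.card_bool, Fintype.card_fun] using this

/-- **Subcube loss bound for `k`-form strategies.**  For `m ≤ n` with `(n+1)·2p^k·(2p−1)^m < (2p)^m`, every `k`-form strategy
on `n` bits loses on at least `2^{n−m}` inputs. -/
theorem kForm_loss_lower_bound (ω ζ : K) (hω : IsPrimitiveRoot ω p) (hζ : IsPrimitiveRoot ζ 3)
    (hp5 : 5 ≤ p) (n m k : ℕ) (hm : m ≤ n)
    (hcount : (n + 1) * (p ^ k * 2) * (2 * p - 1) ^ m < (2 * p) ^ m) (c : ℕ)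
    (lam : Fin (n + 1) → Fin k → Fin n → ZMod p) (F : Fin (n + 1) → (Fin k → ZMod p) → Bool)
    (y : Fin (n + 1) → (Fin n → Bool) → Bool)
    (hy : ∀ g u, y g u = F g (fun j => ∑ i, if u i = true then lam g j i else 0)) :
    2 ^ (n - m) ≤ (univ.filter fun u : Fin n → Bool => ringWinU c y u = false).card := by
  obtain ⟨q, rfl⟩ := Nat.exists_eq_add_of_le hm
  rw [Nat.add_sub_cancel_left]
  exact kForm_loss_lower_bound_add ω ζ hω hζ hp5 m q k hcount c lam F y hy

end SubcubeK

end CharTwoKill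

/-! ### §2 Instantiation: every prime `p ≥ 5` -/

section InstantiateK

variable (p : ℕ) [Fact p.Prime]

/-- **Subcube loss bound for `k`-form strategies, every prime `p ≥ 5`.**  If cut `g` decides by an arbitrary table `F g` of
`k` linear forms `mod p` of the input, `m ≤ n` and `(n+1)·2p^k·(2p−1)^m < (2p)^m`, then the strategy loses on `≥ 2^{n−m}` inputs. -/
theorem kForm_loss_ge (hp5 : 5 ≤ p) {n k : ℕ} (m : ℕ) (hm : m ≤ n)
    (hcount : (n + 1) * (p ^ k * 2) * (2 * p - 1) ^ m < (2 * p) ^ m) (c : ℕ)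
    (lam : Fin (n + 1) → Fin k → Fin n → ZMod p) (F : Fin (n + 1) → (Fin k → ZMod p) → Bool)
    (y : Fin (n + 1) → (Fin n → Bool) → Bool)
    (hy : ∀ g u, y g u = F g (fun j => ∑ i, if u i = true then lam g j i else 0)) :
    2 ^ (n - m) ≤ (univ.filter fun u : Fin n → Bool => ringWinU c y u = false).card := by
  obtain ⟨hK, ω, ζ, hω, hζ⟩ := exists_charTwo_roots p hp5
  exact CharTwoKill.kForm_loss_lower_bound ω ζ hω hζ hp5 n m k hm hcount c lam F y hy

/-- Item-style form of the `k`-form subcube loss bound (the `k`-form analogue of `linSelSubcubeLossOdd`, stmt-22607). -/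
theorem kFormSubcubeLossOdd : ∀ (p : ℕ) [Fact p.Prime], 5 ≤ p → ∀ n m k : ℕ, m ≤ n →
    (n + 1) * (p ^ k * 2) * (2 * p - 1) ^ m < (2 * p) ^ m → ∀ c : ℕ,
    ∀ lam : Fin (n + 1) → Fin k → Fin n → ZMod p, ∀ F : Fin (n + 1) → (Fin k → ZMod p) → Bool,
    ∀ y : Fin (n + 1) → (Fin n → Bool) → Bool,
      (∀ g u, y g u = F g (fun j => Finset.univ.sum fun i => if u i = true then lam g j i else 0)) →
        2 ^ (n - m) ≤ (Finset.univ.filter fun u : Fin n → Bool => ringWinU c y u = false).card :=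
  fun p _ hp _n m _k hm hcount c lam F y hy => kForm_loss_ge p hp m hm hcount c lam F y hy

/-- **Subcube loss bound for junta ⊕ linear-form strategies.**  A cut «junta `J` (`|J| ≤ L`) ⊕ ONE linear form» is an
`(L+1)`-form cut (`PerfectDial.kform_of_jlin`); so for `m ≤ n` with `(n+1)·2p^{L+1}·(2p−1)^m < (2p)^m` every such strategy
loses on `≥ 2^{n−m}` inputs. -/
theorem jlin_loss_ge (hp5 : 5 ≤ p) {n L : ℕ} (m : ℕ) (hm : m ≤ n)
    (hcount : (n + 1) * (p ^ (L + 1) * 2) * (2 * p - 1) ^ m < (2 * p) ^ m) (c : ℕ)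
    (y : Fin (n + 1) → (Fin n → Bool) → Bool)
    (hy : ∀ g, ∃ J : Finset (Fin n), J.card ≤ L ∧ ∃ a : Fin n → ZMod p, ∃ h : (Fin n → Bool) → ZMod p → Bool,
      (∀ u v : Fin n → Bool, (∀ i ∈ J, u i = v i) → ∀ s, h u s = h v s) ∧ ∀ u, y g u = h u (∑ i, if u i then a i else 0)) :
    2 ^ (n - m) ≤ (univ.filter fun u : Fin n → Bool => ringWinU c y u = false).card := by
  obtain ⟨lam, F, hF⟩ := Summit.QuantumAdvantage.QuantumAdvantage.Theorems.PerfectDial.kform_of_jlin y hy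
  exact kForm_loss_ge p hp5 m hm hcount c lam F y hF

end InstantiateK

/-! ### §3 Counting: `m = k₀·log₂ n` peels suffice for `log₂ n + 1` forms -/

section Counting

/-- `a² ≤ 2^{a+1}`. -/
theorem sq_le_two_pow_succ (a : ℕ) : a * a ≤ 2 ^ (a + 1) := by
  induction a with
  | zero => simp
  | succ a ih =>
    have h1 : a < 2 ^ a := Nat.lt_two_pow_self
    have e1 : 2 ^ (a + 1 + 1) = 2 ^ (a + 1) * 2 := pow_succ _ _
    have e2 : 2 ^ (a + 1) = 2 ^ a * 2 := pow_succ _ _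
    rw [e1]
    nlinarith

/-- `k₀·log₂ n ≤ n` once `n ≥ 2^{2k₀}`. -/
theorem mul_log_le_self (k₀ n : ℕ) (hn : 2 ^ (2 * k₀) ≤ n) : k₀ * Nat.log 2 n ≤ n := by
  have hn0 : n ≠ 0 := by
    have : 0 < 2 ^ (2 * k₀) := Nat.two_pow_pos _
    omega
  set a := Nat.log 2 n with ha
  have ha2 : 2 * k₀ ≤ a := by
    rw [ha]
    calc 2 * k₀ = Nat.log 2 (2 ^ (2 * k₀)) := (Nat.log_pow (by norm_num) _).symm
      _ ≤ Nat.log 2 n := Nat.log_mono_right hn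
  have hsq := sq_le_two_pow_succ a
  have hpow : 2 ^ a ≤ n := by rw [ha]; exact Nat.pow_log_le_self 2 hn0
  have e2 : 2 ^ (a + 1) = 2 ^ a * 2 := pow_succ _ _
  have h3 : 2 * (k₀ * a) ≤ a * a := by nlinarith
  omega

/-- the real-number core: a ratio `> 1` raised to a suitable power beats any constant. -/
theorem exists_pow_ratio_gt (P B : ℕ) (hP : 1 ≤ P) : ∃ k₀ : ℕ, B * P ^ k₀ < (P + 1) ^ k₀ := by
  have hP0 : (0 : ℝ) < P := by exact_mod_cast hP
  have hr : (1 : ℝ) < ((P : ℝ) + 1) / P := by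
    rw [lt_div_iff₀ hP0]; linarith
  obtain ⟨k₀, hk₀⟩ := pow_unbounded_of_one_lt (B : ℝ) hr
  refine ⟨k₀, ?_⟩
  have hPk : (0 : ℝ) < (P : ℝ) ^ k₀ := pow_pos hP0 _
  have key : (B : ℝ) * (P : ℝ) ^ k₀ < ((P : ℝ) + 1) ^ k₀ := by
    rw [div_pow, lt_div_iff₀ hPk] at hk₀
    exact hk₀
  exact_mod_cast key

/-- **The counting inequality for `log₂ n + 1` forms with `m = k₀·log₂ n` peels**: for every `p ≥ 2` there are `k₀, n₀` such
that for all `n ≥ n₀`, `k₀·log₂ n ≤ n` and `(n+1)·2p^{log₂ n + 1}·(2p−1)^{k₀ log₂ n} < (2p)^{k₀ log₂ n}`. -/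
theorem count_log_loss (p : ℕ) (hp : 2 ≤ p) :
    ∃ k₀ n₀ : ℕ, ∀ n ≥ n₀, k₀ * Nat.log 2 n ≤ n ∧
      (n + 1) * (p ^ (Nat.log 2 n + 1) * 2) * (2 * p - 1) ^ (k₀ * Nat.log 2 n) < (2 * p) ^ (k₀ * Nat.log 2 n) := by
  -- a power `k₀` of the ratio `2p/(2p−1)` beating `16·p²`
  obtain ⟨k₀, hk₀⟩ := exists_pow_ratio_gt (2 * p - 1) (16 * p ^ 2) (by omega)
  have hP1 : 2 * p - 1 + 1 = 2 * p := by omega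
  rw [hP1] at hk₀
  refine ⟨k₀, max (2 ^ (2 * k₀)) 4, fun n hn => ?_⟩
  have hn4 : 4 ≤ n := le_trans (le_max_right _ _) hn
  have hn0 : n ≠ 0 := by omega
  refine ⟨mul_log_le_self k₀ n (le_trans (le_max_left _ _) hn), ?_⟩
  set a := Nat.log 2 n with ha
  -- `a ≥ 2` and `2^a > n/2`
  have ha2 : 2 ≤ a := by
    rw [ha]
    calc 2 = Nat.log 2 (2 ^ 2) := (Nat.log_pow (by norm_num) _).symm
      _ ≤ Nat.log 2 n := Nat.log_mono_right (by omega)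
  have h2a : n < 2 ^ (a + 1) := by rw [ha]; exact Nat.lt_pow_succ_log_self (by norm_num) n
  -- per unit of `a`: `(2p)^{k₀} > 16 p² (2p−1)^{k₀}`; raise to the `a`-th power
  have hpowa : (16 * p ^ 2 * (2 * p - 1) ^ k₀) ^ a < ((2 * p) ^ k₀) ^ a :=
    Nat.pow_lt_pow_left hk₀ (by omega)
  have e1 : (16 * p ^ 2 * (2 * p - 1) ^ k₀) ^ a = 16 ^ a * (p ^ a * p ^ a) * (2 * p - 1) ^ (k₀ * a) := by
    rw [mul_pow, mul_pow, ← pow_mul, ← pow_mul, pow_mul]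
    ring
  have e2 : ((2 * p) ^ k₀) ^ a = (2 * p) ^ (k₀ * a) := by rw [← pow_mul]
  rw [e1, e2] at hpowa
  -- it remains to see `(n+1)·2p·p^{a} ≤ 16^a · p^a · p^a`
  have h16 : (n + 1) * (n + 1) * ((n + 1) * (n + 1)) ≤ 16 ^ a * 16 := by
    have : n + 1 ≤ 2 ^ (a + 1) := h2a
    have e3 : 16 ^ a * 16 = (2 ^ (a + 1)) * (2 ^ (a + 1)) * ((2 ^ (a + 1)) * (2 ^ (a + 1))) := by
      rw [show (16 : ℕ) = 2 ^ 4 by norm_num, ← pow_mul]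
      ring
    rw [e3]
    have h' := Nat.mul_le_mul this this
    exact Nat.mul_le_mul h' h'
  have hpa : p ≤ p ^ a := by
    calc p = p ^ 1 := (pow_one p).symm
      _ ≤ p ^ a := Nat.pow_le_pow_right (by omega) (by omega)
  have hsmall : (n + 1) * (p ^ (a + 1) * 2) ≤ 16 ^ a * (p ^ a * p ^ a) := by
    -- `(n+1)·2p ≤ 16^a` for `n ≥ 4`... via `(n+1)^4 ≤ 16^{a+1}` and `32·(n+1)·p ≤ (n+1)^4 · p`? No: use `p ≤ p^a` and `(n+1)·2 ≤ 16^a /1`.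
    have hn16 : (n + 1) * 2 * 16 ≤ 16 ^ a * 16 := by
      have h5 : 5 ≤ n + 1 := by omega
      have h125 : 5 * (5 * 5) ≤ (n + 1) * ((n + 1) * (n + 1)) := Nat.mul_le_mul h5 (Nat.mul_le_mul h5 h5)
      have : (n + 1) * 2 * 16 ≤ (n + 1) * (n + 1) * ((n + 1) * (n + 1)) := by
        calc (n + 1) * 2 * 16 = (n + 1) * 32 := by ring
          _ ≤ (n + 1) * ((n + 1) * ((n + 1) * (n + 1))) := Nat.mul_le_mul_left _ (by omega)
          _ = (n + 1) * (n + 1) * ((n + 1) * (n + 1)) := by ring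
      exact le_trans this h16
    have hn2 : (n + 1) * 2 ≤ 16 ^ a := by
      have := hn16; omega
    calc (n + 1) * (p ^ (a + 1) * 2) = ((n + 1) * 2) * (p ^ a * p) := by rw [pow_succ]; ring
      _ ≤ 16 ^ a * (p ^ a * p ^ a) := Nat.mul_le_mul hn2 (Nat.mul_le_mul_left _ hpa)
  calc (n + 1) * (p ^ (a + 1) * 2) * (2 * p - 1) ^ (k₀ * a)
      ≤ 16 ^ a * (p ^ a * p ^ a) * (2 * p - 1) ^ (k₀ * a) := Nat.mul_le_mul_right _ hsmall
    _ < (2 * p) ^ (k₀ * a) := hpowa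

end Counting

end Coset21

end Summit.QuantumAdvantage.AdviceFreeQNC0
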